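import Literature.Geometry.Kaehler.ComplexTorusWeylOperatorIntegral
import Literature.Geometry.Kaehler.ComplexTorusCohomologyPullbackIndex
import HarnessLib

/-!
# The Weyl operator on rational and integral cohomology of a polarised abelian variety:
# `w : Hᵏ(X, ℚ) ⥲ H^{2g−k}(X, ℚ)`, `w : Hdg^{2p}(X, ℚ) ⥲ Hdg^{2g−2p}(X, ℚ)`, and `[H^{2g−k}(X, ℤ) : χ(d)·w Hᵏ(X, ℤ)] = χ(d)^{2·C(2g−1, 2g−k−1)}`

Layer `Literature/Geometry/Kaehler`, namespace `Literature.Geometry.Kaehler.ComplexTorus`; lane `lit-hodgefound` (Track 2 foundations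
library), prover seat `lit-hodgefound-p09` (generation 51, row g51-#7). THEOREMS ONLY (no definition, no named fact, no instance, no
notation; D-0026 net debt `0`). Sequel of rows g51-#4 (`φ_H^* ∘ F = (−1)^g χ(d)·w`) and g51-#5 (`χ(d)·w` is integral; principal case).

SETTING as in row g51-#5: `X = E/Φ(ℤ^ι)`, `η` a Riemann form of type `d = (d₁, …, d_g)`, `χ(d) = d₁⋯d_g`, `G` the integer Gram matrix
of `η` (`hG`), `φ_H = realRep Φ Φ̂ ᵗG`, `F = fourierForm`, `w` the Weyl operator of the Lefschetz `𝔰𝔩₂` on `H•(X; ℂ) = GForm E ℂ`,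
`Hᵏ(X, ℚ) = rationalForms Φ k`, `Hᵏ(X, ℤ) = integralForms Φ k`, `Hdg^{2p}(X, ℚ) = hodgeClasses Φ p`; `k + m = N = 2g`.

## What is proved

* §1 `fourierForm_compContinuousLinearMap_realRep_mem_rationalForms` (`φ^*F(Hᵏ(X, ℚ)) ⊆ Hᵐ(X, ℚ)`, `φ = realRep Φ Φ̂ A`);
  **`IsPolarizationType.exists_mem_rationalForms_weylOperator_of_eq` / `…_eq_weylOperator_of`: `w` restricts to a bijection
  `Hᵏ(X, ℚ) ⥲ H^{2g−k}(X, ℚ)`** (`w = (−1)^g χ(d)⁻¹ φ_H^* ∘ F` is defined over `ℚ`; onto by `w² = (−1)^{k−g}`) and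
  **`IsPolarizationType.exists_mem_hodgeClasses_eq_weylOperator_of`: `w : Hdg^{2p}(X, ℚ) ⥲ Hdg^{2g−2p}(X, ℚ)` is onto** (the "into"
  half is row g51-#5 `exists_mem_hodgeClasses_weylOperator_of_eq`) — for EVERY polarisation type, the rational Hodge classes in
  complementary degrees are identified by the Weyl element of the Lefschetz `𝔰𝔩₂` (Beauville's `F : Hdg^p(X)_ℚ ⥲ Hdg^{g−p}(X̂)_ℚ` through `φ_H^*`).
* §2 **`IsPolarizationType.map_prod_smul_weylOperator_integralForms`: `χ(d)·w(Hᵏ(X, ℤ)) = φ_H^*(Hᵐ(X̂, ℤ))`** as subgroups of `Hᵐ(X; ℂ)`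
  (`F(Hᵏ(X, ℤ)) = Hᵐ(X̂, ℤ)`, Prop. 6.2.20; `χ(d)·w` is written as the additive map `x ↦ (χ(d)·w(of k x))_m`).
* §3 **`IsPolarizationType.relIndex_map_prod_smul_weylOperator_integralForms`: `[Hᵐ(X, ℤ) : χ(d)·w(Hᵏ(X, ℤ))] = (χ(d)²)^{C(2g−1, m−1)}`**
  for `m ≥ 1` — the cokernel of `φ_H^*` on `Hᵐ` has order `(deg φ_L)^{C(2g−1,m−1)}` (Prop. 1.1.13 (c) in degree `m`,
  `relIndex_map_pullbackAlt_integralForms_of_pos`) and `deg φ_L = det G = χ(d)²` (Prop. 1.4.7). For a principal polarisation the index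
  is `1` (row g51-#5: `w` is a bijection of lattices).

## Sources, VERBATIM

* H. Lange, *Abelian Varieties over the Complex Numbers* (2023) [Lange2023AbelianVarietiesComplex]: §6.2.4 Prop. 6.2.20 p. 310 ("the
  restriction of `F` to `Hᵖ(X, ℤ)` is an isomorphism `Hᵖ(X, ℤ) → H^{2g−p}(X̂, ℤ)`"), Prop. 6.2.21 p. 311; §1.1.2 Prop. 1.1.13 (c) and
  its proof (PDF p. 22: "the index of `ρ_r(f)(Λ)` in `Λ` is given by `det ρ_r(f)`"), §1.1.6 Exercise (7); §1.4.2 Prop. 1.4.7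
  ("`deg φ_L = det(Im H)`") and Lemma 1.4.5 / (1.14).
* A. Polishchuk, *Fourier-stable subrings in the Chow rings of abelian varieties* (2007) [Polishchuk2007FourierStable], §1 Lemma 1.4 (p. 3):
  "`F_d = (1/χ(d)) φ^* ∘ F`", "`(−1)^g F_d = exp(e) exp(−f) exp(e)`".
* A. Beauville (1983) [Beauville1983FourierChow], §1 Prop. 1 (p. 241): `F` maps `Hᵖ(A, ℤ)` onto `H^{2g−p}(Â, ℤ)` and induces an
  isomorphism of Hodge structures.
* D. S. Bernstein, *Matrix Mathematics* (2009) [Bernstein2009], Fact 7.5.17 (xi) (p. 452): `det A^{(k)} = (det A)^{C(n−1,k−1)}`.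

## Scope

The index formula is for the map `χ(d)·w` (integral for every type); the finer index of `w` itself on `w⁻¹`-integral classes and the
index on integral HODGE classes are not computed here.
-/

noncomputable section

-- `Module ℂ` / `SMulZeroClass ℂ` synthesis on `E [⋀^Fin k]→L[ℝ] ℂ` (as in `ComplexTorusLefschetzDecomposition`)
set_option maxSynthPendingDepth 3

namespace Literature.Geometry.Kaehler

namespace ComplexTorus

open Module Function Finset
open Literature.LinearAlgebra.Alternating Literature.Algebra.Lie

universe uE

variable {ι : Type*} [Fintype ι] [LinearOrder ι] {E : Type uE} [NormedAddCommGroup E] [NormedSpace ℂ E]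
  [FiniteDimensional ℂ E] [Nontrivial E] (Φ : (ι → ℝ) ≃L[ℝ] E) {η : E [⋀^Fin 2]→L[ℝ] ℝ} {G : Matrix ι ι ℤ} {N : ℕ}

omit [Fintype ι] [LinearOrder ι] [FiniteDimensional ℂ E] [Nontrivial E] in
/-- `(−1)^g (−1)^g = 1`. [folklore] -/
private theorem neg_one_pow_mul_neg_one_pow₅₅ (g : ℕ) : (-1 : ℂ) ^ g * (-1) ^ g = 1 := by
  rw [← pow_add, ← two_mul, pow_mul, neg_one_sq, one_pow]

omit [Fintype ι] [LinearOrder ι] [FiniteDimensional ℂ E] [Nontrivial E] in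
/-- `g^*(c T) = c g^*T`. [cite: Warner1983, 2.22] -/
private theorem smul_compContinuousLinearMap₅₅ {V W : Type*} [NormedAddCommGroup V] [NormedSpace ℝ V] [NormedAddCommGroup W]
    [NormedSpace ℝ W] {k : ℕ} (c : ℂ) (T : V [⋀^Fin k]→L[ℝ] ℂ) (g : W →L[ℝ] V) :
    (c • T).compContinuousLinearMap g = c • T.compContinuousLinearMap g := by
  ext u; rfl

omit [Fintype ι] [LinearOrder ι] [FiniteDimensional ℂ E] [Nontrivial E] in
/-- `±T` lies in an additive subgroup with `T`. [folklore] -/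
private theorem neg_one_pow_smul_mem₅₅ {k : ℕ} {S : AddSubgroup (E [⋀^Fin k]→L[ℝ] ℂ)} {T : E [⋀^Fin k]→L[ℝ] ℂ} (hT : T ∈ S)
    (g : ℕ) : ((-1 : ℂ) ^ g) • T ∈ S := by
  rcases Nat.even_or_odd g with hg | hg
  · rw [hg.neg_one_pow, one_smul]; exact hT
  · rw [hg.neg_one_pow, neg_one_smul]; exact S.neg_mem hT

omit [Fintype ι] [LinearOrder ι] [FiniteDimensional ℂ E] [Nontrivial E] in
/-- A rational multiple of a member of a `ℚ`-submodule of forms is a member. [folklore] -/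
private theorem ratCast_smul_mem₅₅ {k : ℕ} {S : Submodule ℚ (E [⋀^Fin k]→L[ℝ] ℂ)} {T : E [⋀^Fin k]→L[ℝ] ℂ} (hT : T ∈ S) (q : ℚ) :
    ((q : ℂ)) • T ∈ S := by
  rw [Rat.cast_smul_eq_qsmul]
  exact S.smul_mem q hT

/-! ## §1 `w` on rational cohomology and rational Hodge classes: bijections `Hᵏ(X, ℚ) ⥲ H^{2g−k}(X, ℚ)`, `Hdg^{2p}(ℚ) ⥲ Hdg^{2q}(ℚ)` -/

section Rational

omit [FiniteDimensional ℂ E] [Nontrivial E] in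
/-- **`φ^*F(Hᵏ(X, ℚ)) ⊆ Hᵐ(X, ℚ)`** (`k + m = 2g`) for `φ = realRep Φ Φ̂ A`, `A` an integer matrix: `F` preserves rational classes
(Prop. 6.2.20) and so does the pull-back along an integral map. [cite: Lange2023AbelianVarietiesComplex, §6.2.4 Prop. 6.2.20 p. 310; §1.1.3 Exercise 1.1.6 (7)] -/
theorem fourierForm_compContinuousLinearMap_realRep_mem_rationalForms (A : Matrix ι ι ℤ) (e : Fin N ≃ ι) {k m : ℕ} (h : k + m = N)
    {x : E [⋀^Fin k]→L[ℝ] ℂ} (hx : x ∈ rationalForms Φ k) :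
    (fourierForm Φ e h x).compContinuousLinearMap (realRep Φ (dualPeriod Φ) A) ∈ rationalForms Φ m := by
  subst h
  exact comp_realRep_mem_rationalForms Φ (dualPeriod Φ) A (fourierForm_mem_rationalForms Φ e hx)

/-- **`w` maps `Hᵏ(X, ℚ)` into `H^{2g−k}(X, ℚ)`**: the Weyl operator of the Lefschetz `𝔰𝔩₂` of a polarisation is defined over `ℚ`
(`w = (−1)^g χ(d)⁻¹ φ_H^* ∘ F`, row g51-#5 `IsPolarizationType.weylOperator_of`). [cite: Polishchuk2007FourierStable, §1 Lemma 1.4 (p. 3)]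
[cite: Lange2023AbelianVarietiesComplex, §6.2.4 Prop. 6.2.20 p. 310] -/
theorem IsPolarizationType.exists_mem_rationalForms_weylOperator_of_eq (hR : IsRiemannForm Φ η) {g : ℕ} {d : Fin g → ℕ}
    (hd : IsPolarizationType Φ η d) (hη : ∀ v : E, v ≠ 0 → ∃ w : E, η ![v, w] ≠ 0) (hG : G.map (Int.cast : ℤ → ℝ) = latticeGram Φ η)
    (e : Fin N ≃ ι) {k m : ℕ} (h : k + m = N) {x : E [⋀^Fin k]→L[ℝ] ℂ} (hx : x ∈ rationalForms Φ k) :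
    ∃ y ∈ rationalForms Φ m, (hasLefschetzProperty_lefschetzG hη).weylOperator isZGrading_countingG (GForm.of k x) = GForm.of m y := by
  refine ⟨_, ?_, hd.weylOperator_of Φ hR hη _ (im_realRep_transpose_apply Φ hG) e h x⟩
  have hq : ((-1 : ℂ) ^ g * (∏ i, (d i : ℂ))⁻¹) = (((-1 : ℚ) ^ g * (∏ i, (d i : ℚ))⁻¹ : ℚ) : ℂ) := by push_cast; rfl
  rw [hq]
  exact ratCast_smul_mem₅₅ (fourierForm_compContinuousLinearMap_realRep_mem_rationalForms Φ G.transpose e h hx) _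

/-- **`w` maps `Hᵏ(X, ℚ)` ONTO `H^{2g−k}(X, ℚ)`** — so `w : Hᵏ(X, ℚ) ⥲ H^{2g−k}(X, ℚ)`: apply the previous statement in degree `m` and
`w(w(y)) = (−1)^{m−g} y` (the central element of `SL₂`). [cite: Polishchuk2007FourierStable, §1 Lemma 1.4 (p. 3)] [cite: Andre1996Motifs, §1.2 (p. 11)]
[cite: Lange2023AbelianVarietiesComplex, §6.2.4 Prop. 6.2.20 p. 310] -/
theorem IsPolarizationType.exists_mem_rationalForms_eq_weylOperator_of (hR : IsRiemannForm Φ η) {g : ℕ} {d : Fin g → ℕ}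
    (hd : IsPolarizationType Φ η d) (hη : ∀ v : E, v ≠ 0 → ∃ w : E, η ![v, w] ≠ 0) (hG : G.map (Int.cast : ℤ → ℝ) = latticeGram Φ η)
    (e : Fin N ≃ ι) {k m : ℕ} (h : k + m = N) {y : E [⋀^Fin m]→L[ℝ] ℂ} (hy : y ∈ rationalForms Φ m) :
    ∃ x ∈ rationalForms Φ k, (hasLefschetzProperty_lefschetzG hη).weylOperator isZGrading_countingG (GForm.of k x) = GForm.of m y := by
  obtain ⟨x₁, hx₁, h₁⟩ := hd.exists_mem_rationalForms_weylOperator_of_eq Φ hR hη hG e (by omega : m + k = N) hy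
  have h₂ := (hasLefschetzProperty_lefschetzG hη).weylOperator_weylOperator_apply_of_mem isZGrading_countingG
    (of_mem_degreeSpace_countingG (E := E) m y)
  rw [h₁] at h₂
  refine ⟨((-1 : ℂ) ^ ((m : ℤ) - (finrank ℂ E : ℤ)).natAbs) • x₁, ?_, ?_⟩
  · have hq : ((-1 : ℂ) ^ ((m : ℤ) - (finrank ℂ E : ℤ)).natAbs) = (((-1 : ℚ) ^ ((m : ℤ) - (finrank ℂ E : ℤ)).natAbs : ℚ) : ℂ) := by
      push_cast; rfl
    rw [hq]
    exact ratCast_smul_mem₅₅ hx₁ _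
  · rw [GForm.of_smul, map_smul, h₂, smul_smul, neg_one_pow_mul_neg_one_pow₅₅, one_smul]

/-- **`w` maps `Hdg^{2p}(X, ℚ)` ONTO `Hdg^{2q}(X, ℚ)`** (`p + q = g`) — with row g51-#5's "into" half, **`w : Hdg^{2p}(X, ℚ) ⥲ Hdg^{2g−2p}(X, ℚ)`
for every polarised complex torus**: the rational Hodge classes in complementary degrees are identified by the Weyl element of the
Lefschetz `𝔰𝔩₂` (Beauville's isomorphism of Hodge structures `F`, Prop. 6.2.21, through `φ_H^*`).
[cite: Lange2023AbelianVarietiesComplex, §6.2.4 Prop. 6.2.20 p. 310, Prop. 6.2.21 p. 311] [cite: Beauville1983FourierChow, §1 Prop. 1 (p. 241)]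
[cite: Polishchuk2007FourierStable, §1 Lemma 1.4 (p. 3)] [cite: Andre1996Motifs, §1.2 (p. 11)] -/
theorem IsPolarizationType.exists_mem_hodgeClasses_eq_weylOperator_of (hR : IsRiemannForm Φ η) {g : ℕ} {d : Fin g → ℕ}
    (hd : IsPolarizationType Φ η d) (hη : ∀ v : E, v ≠ 0 → ∃ w : E, η ![v, w] ≠ 0) (hG : G.map (Int.cast : ℤ → ℝ) = latticeGram Φ η)
    (e : Fin N ≃ ι) {p q : ℕ} (h : 2 * p + 2 * q = N) {y : E [⋀^Fin (2 * q)]→L[ℝ] ℂ} (hy : y ∈ hodgeClasses Φ q) :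
    ∃ x ∈ hodgeClasses Φ p,
      (hasLefschetzProperty_lefschetzG hη).weylOperator isZGrading_countingG (GForm.of (2 * p) x) = GForm.of (2 * q) y := by
  obtain ⟨x₁, hx₁, h₁⟩ := hd.exists_mem_hodgeClasses_weylOperator_of_eq Φ hR hη hG e (by omega : 2 * q + 2 * p = N) hy
  have h₂ := (hasLefschetzProperty_lefschetzG hη).weylOperator_weylOperator_apply_of_mem isZGrading_countingG
    (of_mem_degreeSpace_countingG (E := E) (2 * q) y)
  rw [h₁] at h₂
  refine ⟨((-1 : ℂ) ^ (((2 * q : ℕ) : ℤ) - (finrank ℂ E : ℤ)).natAbs) • x₁, ?_, ?_⟩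
  · have hq : ((-1 : ℂ) ^ (((2 * q : ℕ) : ℤ) - (finrank ℂ E : ℤ)).natAbs) =
        (((-1 : ℚ) ^ (((2 * q : ℕ) : ℤ) - (finrank ℂ E : ℤ)).natAbs : ℚ) : ℂ) := by
      push_cast; rfl
    rw [hq]
    exact ratCast_smul_mem₅₅ hx₁ _
  · rw [GForm.of_smul, map_smul, h₂, smul_smul, neg_one_pow_mul_neg_one_pow₅₅, one_smul]

end Rational

/-! ## §2 The image of `χ(d)·w` on `Hᵏ(X, ℤ)` is `φ_H^* Hᵐ(X̂, ℤ)` -/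

section Image

/-- **`χ(d)·w(Hᵏ(X, ℤ)) = φ_H^*(Hᵐ(X̂, ℤ))`** as additive subgroups of `Hᵐ(X; ℂ)` (`k + m = 2g`): `χ(d)·w = (−1)^g φ_H^* ∘ F` (row g51-#5)
and `F(Hᵏ(X, ℤ)) = Hᵐ(X̂, ℤ)` (Prop. 6.2.20, both inclusions: `fourierForm_mem_integralForms`, `exists_fourierForm_eq_of_mem_integralForms`);
`χ(d)·w` on `Hᵏ` is written as the additive map `x ↦ (χ(d)·w(of k x))_m` and `φ_H^*` as `pullbackAlt (realRep Φ Φ̂ ᵗG) m`.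
[cite: Lange2023AbelianVarietiesComplex, §6.2.4 Prop. 6.2.20 p. 310; §1.4.2 Lemma 1.4.5] [cite: Polishchuk2007FourierStable, §1 Lemma 1.4 (p. 3)] -/
theorem IsPolarizationType.map_prod_smul_weylOperator_integralForms (hR : IsRiemannForm Φ η) {g : ℕ} {d : Fin g → ℕ}
    (hd : IsPolarizationType Φ η d) (hη : ∀ v : E, v ≠ 0 → ∃ w : E, η ![v, w] ≠ 0) (hG : G.map (Int.cast : ℤ → ℝ) = latticeGram Φ η)
    (e : Fin N ≃ ι) {k m : ℕ} (h : k + m = N) :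
    (integralForms Φ k).map
        (LinearMap.proj m ∘ₗ ((∏ i, (d i : ℂ)) • (hasLefschetzProperty_lefschetzG hη).weylOperator isZGrading_countingG) ∘ₗ
          LinearMap.single ℂ (fun j ↦ E [⋀^Fin j]→L[ℝ] ℂ) k).toAddMonoidHom =
      (integralForms (dualPeriod Φ) m).map (pullbackAlt (realRep Φ (dualPeriod Φ) G.transpose) m).toAddMonoidHom := by
  have hT : ∀ x : E [⋀^Fin k]→L[ℝ] ℂ,
      (LinearMap.proj m ∘ₗ ((∏ i, (d i : ℂ)) • (hasLefschetzProperty_lefschetzG hη).weylOperator isZGrading_countingG) ∘ₗ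
          LinearMap.single ℂ (fun j ↦ E [⋀^Fin j]→L[ℝ] ℂ) k) x =
        ((-1 : ℂ) ^ g) • (fourierForm Φ e h x).compContinuousLinearMap (realRep Φ (dualPeriod Φ) G.transpose) := fun x ↦ by
    have key := hd.prod_smul_weylOperator_of Φ hR hη hG e h x
    rw [LinearMap.comp_apply, LinearMap.comp_apply, LinearMap.coe_single, LinearMap.smul_apply,
      show (Pi.single k x : GForm E ℂ) = GForm.of k x from rfl, key, LinearMap.proj_apply, GForm.of_apply_self]
  subst h
  ext y
  simp only [AddSubgroup.mem_map, LinearMap.toAddMonoidHom_coe, hT]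
  constructor
  · rintro ⟨x, hx, rfl⟩
    refine ⟨((-1 : ℂ) ^ g) • fourierForm Φ e rfl x, neg_one_pow_smul_mem₅₅ (fourierForm_mem_integralForms Φ e hx) g, ?_⟩
    rw [map_smul]
    rfl
  · rintro ⟨z, hz, rfl⟩
    obtain ⟨x, hx, hxz⟩ := exists_fourierForm_eq_of_mem_integralForms Φ e hz
    refine ⟨((-1 : ℂ) ^ g) • x, neg_one_pow_smul_mem₅₅ hx g, ?_⟩
    rw [fourierForm_smul, ← hxz, smul_compContinuousLinearMap₅₅, smul_smul, neg_one_pow_mul_neg_one_pow₅₅, one_smul]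
    rfl

end Image

/-! ## §3 The index: `[Hᵐ(X, ℤ) : χ(d)·w(Hᵏ(X, ℤ))] = (χ(d)²)^{C(2g−1, m−1)}` -/

section Index

omit [LinearOrder ι] [FiniteDimensional ℂ E] [Nontrivial E] in
/-- `det G = (d₁⋯d_g)²` over `ℤ` for the integer Gram matrix of a polarisation of type `d`. [cite: Lange2023AbelianVarietiesComplex, §1.4.2 Prop. 1.4.7 and §2.4.4] -/
private theorem det_eq_prod_sq₅₅ [DecidableEq ι] (hG : G.map (Int.cast : ℤ → ℝ) = latticeGram Φ η) {g : ℕ} {d : Fin g → ℕ}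
    (hd : IsPolarizationType Φ η d) : G.det = ((∏ i, d i) ^ 2 : ℕ) := by
  have h1 : ((G.det : ℤ) : ℝ) = (latticeGram Φ η).det := by rw [← hG, Int.cast_det]
  rw [hd.det_latticeGram] at h1
  exact_mod_cast h1

/-- **`[Hᵐ(X, ℤ) : χ(d)·w(Hᵏ(X, ℤ))] = (χ(d)²)^{C(2g−1, m−1)}`** for `m ≥ 1` (`k + m = 2g`, `χ(d) = d₁⋯d_g`): the image of the integral
operator `χ(d)·w` on `Hᵏ(X, ℤ)` is `φ_H^* Hᵐ(X̂, ℤ)` (§2), whose index in `Hᵐ(X, ℤ)` is `|det ρ_r(φ_L)|^{C(2g−1,m−1)} = (deg φ_L)^{C(2g−1,m−1)}`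
(Prop. 1.1.13 (c) in degree `m`, Sylvester–Franke; `relIndex_map_pullbackAlt_integralForms_of_pos`) with `deg φ_L = det G = χ(d)²`
(Prop. 1.4.7). For a principal polarisation the index is `1` (row g51-#5).
[cite: Lange2023AbelianVarietiesComplex, §1.1.2 proof of Prop. 1.1.13 (c) (PDF p. 22), §1.1.6 Exercise (7), §1.4.2 Prop. 1.4.7, §6.2.4 Prop. 6.2.20]
[cite: Bernstein2009, Fact 7.5.17 (xi) (p. 452)] [cite: Polishchuk2007FourierStable, §1 Lemma 1.4 (p. 3)] -/
theorem IsPolarizationType.relIndex_map_prod_smul_weylOperator_integralForms (hR : IsRiemannForm Φ η) {g : ℕ} {d : Fin g → ℕ}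
    (hd : IsPolarizationType Φ η d) (hη : ∀ v : E, v ≠ 0 → ∃ w : E, η ![v, w] ≠ 0) (hG : G.map (Int.cast : ℤ → ℝ) = latticeGram Φ η)
    (e : Fin N ≃ ι) {k m : ℕ} (h : k + m = N) (hm : 1 ≤ m) :
    ((integralForms Φ k).map
        (LinearMap.proj m ∘ₗ ((∏ i, (d i : ℂ)) • (hasLefschetzProperty_lefschetzG hη).weylOperator isZGrading_countingG) ∘ₗ
          LinearMap.single ℂ (fun j ↦ E [⋀^Fin j]→L[ℝ] ℂ) k).toAddMonoidHom).relIndex (integralForms Φ m) =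
      ((∏ i, d i) ^ 2) ^ ((Fintype.card ι - 1).choose (m - 1)) := by
  have hdet : G.transpose.det ≠ 0 := by
    rw [Matrix.det_transpose, det_eq_prod_sq₅₅ Φ hG hd]
    exact_mod_cast pow_ne_zero 2 (prod_ne_zero_iff.2 fun i _ ↦ (hd.pos hR i).ne')
  rw [hd.map_prod_smul_weylOperator_integralForms Φ hR hη hG e h,
    relIndex_map_pullbackAlt_integralForms_of_pos Φ (dualPeriod Φ) hdet hm, Matrix.det_transpose, det_eq_prod_sq₅₅ Φ hG hd,
    Int.natAbs_natCast]

end Index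

end ComplexTorus

end Literature.Geometry.Kaehler

end
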